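import Summits.RiemannHypothesis.RiemannHypothesis.Theorems.WeilOffLineSplit
import Literature.NumberTheory.LFunctions.FordZetaZeroRecipSqSum
import HarnessLib

/-!
# No lever above a verified height: the off-line budget of Weil's form is `O(C_g²/T₀²)`

Structure seat rh-explicit-weil-3 (gen6), supporting `stmt-RiemannHypothesis-0098`; sequel of
`WeilOffLineSplit.lean` (the exact split `Re Q(g) = ∑ m‖(a+b)/2‖² − ∑ m‖(a−b)/2‖²`,
`a = ĝ(ρ)`, `b = ĝ(1 − ρ̄)`, whose second series is carried by the off-line zeros only).
Everything PROVED; `C_g = weilDecayConst g = ∫ (‖g‖ + ‖g''‖) e^{|x|/2}`.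

* `exists_offLine_zero_of_re_neg` — `Re Q(g) < 0 ⇒ ∃` a non-trivial zero `ρ` with `Re ρ ≠ 1/2`
  and `ĝ(ρ) ≠ ĝ(1 − ρ̄)` (the window's `sinh`-transform does not vanish at the culprit).
* `norm_weilMellin_sub_reflect_le` — on a window `tsupport g ⊆ [−t, t]`:
  `‖ĝ(ρ) − ĝ(1 − ρ̄)‖ ≤ 2 sinh(|Re ρ − 1/2|·t) ∫‖g‖` (so one off-line zero `ρ = β + iγ` can
  lower `Re Q(g)` by at most `m(ρ) sinh²(|β − 1/2| t) (∫‖g‖)²`).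
* `offLine_term_le_of_rh_upTo`, `tsum_offLine_le_of_rh_upTo` — if every non-trivial zero with
  `|Im ρ| ≤ T₀` (`T₀ ≥ 0`) lies on the line, each term of the off-line series is
  `≤ (C_g²/(1+T₀²)) · m(ρ)/|ρ|²` (it is `0` below the height; above it
  `(1 + γ²)² ≥ (1 + T₀²)(1 + γ²) ≥ (1 + T₀²)|ρ|²`), so the series is
  `≤ (C_g²/(1+T₀²)) ∑_ρ m(ρ)/|ρ|²`.
* `neg_le_re_weilQuadratic_of_rh_upTo` — **NO LEVER ABOVE A VERIFIED HEIGHT**: then for EVERY test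
  function `Re Q(g) ≥ −(463/10000) · C_g² / (1 + T₀²)` (Ford 2002, Lemma 3.3:
  `∑_ρ m(ρ)/|ρ|² ≤ 0.0463`, the tree's `tsum_zeroOrder_div_norm_sq_le`).
* `neg_le_re_weilQuadratic_plattTrudgian` — at the Platt–Trudgian height `T₀ = 3 000 175 332 800`
  (hypothesis inlined exactly as in `WeilAdversary.AdversaryTransfer`; `rh_upTo_of_upper` passes
  from the upper half-plane form to `|Im ρ| ≤ T₀` by `riemannZeta_conj`):
  `Re Q(g) ≥ −(52/10²⁸) · C_g²`.

Reading: whatever the truth of RH above `T₀`, at a FIXED test function the off-line zeros can lower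
Weil's form by at most `0.0463 C_g²/(1+T₀²)`; a negativity witness at any window must therefore
carry `C_g² ≳ 2·10²⁶ |Re Q(g)|`, i.e. derivatives of size `≈ 10¹³` — it must oscillate at
frequencies comparable to `√T₀` or live far out on the `e^{|x|/2}` weight. References: Bombieri 2000
§13 (numerical critical support for a fictitious off-line zero); K. Ford 2002, Lemma 3.3;
D. Platt, T. Trudgian, Bull. LMS 53 (2021) (the height, used only as a hypothesis).
-/

noncomputable section

set_option linter.dupNamespace false  -- the mandated namespace repeats `RiemannHypothesis`

open Complex Filter Set MeasureTheory Topology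
open scoped Real ComplexConjugate

namespace Summit.RiemannHypothesis.RiemannHypothesis.Theorems.WeilOffLine

open Literature.NumberTheory.LFunctions Literature.NumberTheory.LFunctions.WeilConverse

/-! ### Negativity points at an off-line zero -/

/-- **A negative value locates an off-line zero through the window's own transform**: if
`Re Q(g) < 0` for a test function `g`, then some non-trivial zero `ρ` has `Re ρ ≠ 1/2` AND
`ĝ(ρ) ≠ ĝ(1 − ρ̄)`, i.e. `∫ g(x) sinh((Re ρ − 1/2)x) e^{i Im ρ x} dx ≠ 0` (otherwise every term of
the off-line series vanishes and `Re Q(g) ≥ 0` by the budget). The effective form of "negativity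
refutes RH": the culprit zero is one the window actually sees. [folklore] -/
theorem exists_offLine_zero_of_re_neg {g : ℝ → ℂ} (hg : IsWeilTest g)
    (hneg : (weilQuadratic g).re < 0) :
    ∃ ρ ∈ ZetaZeros.riemannZetaNontrivialZeros,
      ρ.re ≠ 1 / 2 ∧ weilMellin g ρ ≠ weilMellin g (1 - conj ρ) := by
  by_contra hcon
  push Not at hcon
  have hzero : ∀ ρ : ZetaZeros.riemannZetaNontrivialZeros,
      (riemannZetaZeroOrder (ρ : ℂ) : ℝ) *
        ‖(weilMellin g ρ - weilMellin g (1 - conj (ρ : ℂ))) / 2‖ ^ 2 = 0 := by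
    intro ρ
    have hab : weilMellin g ρ - weilMellin g (1 - conj (ρ : ℂ)) = 0 := by
      by_cases hρ : (ρ : ℂ).re = 1 / 2
      · exact weilMellin_sub_reflect_eq_zero g hρ
      · exact sub_eq_zero.2 (hcon ρ ρ.2 hρ)
    rw [hab, zero_div, norm_zero, zero_pow two_ne_zero, mul_zero]
  have h := neg_tsum_le_re_weilQuadratic hg
  rw [tsum_congr hzero, tsum_zero, neg_zero] at h
  exact absurd hneg (not_lt.2 h)

/-! ### The size of one off-line term on a window -/

/-- **Window bound for the off-line part**: if `g` is continuous with `tsupport g ⊆ [−t, t]` then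
`‖ĝ(ρ) − ĝ(1 − ρ̄)‖ ≤ 2 sinh(|Re ρ − 1/2|·t) ∫ ‖g‖` (`|sinh((β−1/2)x)| ≤ sinh(|β−1/2| t)` on the
support). [folklore] -/
theorem norm_weilMellin_sub_reflect_le {g : ℝ → ℂ} (hgc : Continuous g)
    (hgs : HasCompactSupport g) {t : ℝ} (ht : tsupport g ⊆ Icc (-t) t) (ρ : ℂ) :
    ‖weilMellin g ρ - weilMellin g (1 - conj ρ)‖ ≤
      2 * Real.sinh (|ρ.re - 1 / 2| * t) * ∫ x : ℝ, ‖g x‖ := by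
  rw [weilMellin_sub_reflect hgc hgs, norm_mul, Complex.norm_ofNat, mul_assoc]
  refine mul_le_mul_of_nonneg_left ?_ (by norm_num)
  rw [← integral_const_mul]
  refine (norm_integral_le_integral_norm _).trans (integral_mono_of_nonneg
    (Eventually.of_forall fun _ ↦ norm_nonneg _) ?_ (Eventually.of_forall fun x ↦ ?_))
  · exact ((hgc.norm).integrable_of_hasCompactSupport hgs.norm).const_mul _
  · simp only [norm_mul, Complex.norm_real, Real.norm_eq_abs, Complex.norm_exp_ofReal_mul_I,
      mul_one]
    by_cases hx : x ∈ tsupport g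
    · have hxt : |x| ≤ t := abs_le.2 ⟨by linarith [(ht hx).1], (ht hx).2⟩
      have hs : |Real.sinh ((ρ.re - 1 / 2) * x)| ≤ Real.sinh (|ρ.re - 1 / 2| * t) := by
        rw [Real.abs_sinh, abs_mul]
        exact Real.sinh_le_sinh.2 (mul_le_mul_of_nonneg_left hxt (abs_nonneg _))
      calc ‖g x‖ * |Real.sinh ((ρ.re - 1 / 2) * x)|
          ≤ ‖g x‖ * Real.sinh (|ρ.re - 1 / 2| * t) :=
            mul_le_mul_of_nonneg_left hs (norm_nonneg _)
        _ = Real.sinh (|ρ.re - 1 / 2| * t) * ‖g x‖ := mul_comm _ _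
    · have h0 : g x = 0 := image_eq_zero_of_notMem_tsupport hx
      simp [h0]

/-! ### No lever above a verified height -/

/-- One term of the off-line series above a verified height: if every non-trivial zero with
`|Im ρ| ≤ T₀` lies on the line (`T₀ ≥ 0`), then for every non-trivial zero `ρ`
`m(ρ) ‖(ĝ(ρ) − ĝ(1−ρ̄))/2‖² ≤ (C_g²/(1 + T₀²)) · m(ρ)/|ρ|²` (the term is `0` below the height, and
above it `(1 + γ²)² ≥ (1 + T₀²)(1 + γ²) ≥ (1 + T₀²)|ρ|²`). [folklore] -/
theorem offLine_term_le_of_rh_upTo {g : ℝ → ℂ} (hg : IsWeilTest g) {T₀ : ℝ} (hT₀ : 0 ≤ T₀)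
    (hRH : ∀ ρ ∈ ZetaZeros.riemannZetaNontrivialZeros, |ρ.im| ≤ T₀ → ρ.re = 1 / 2)
    (ρ : ZetaZeros.riemannZetaNontrivialZeros) :
    (riemannZetaZeroOrder (ρ : ℂ) : ℝ) *
        ‖(weilMellin g ρ - weilMellin g (1 - conj (ρ : ℂ))) / 2‖ ^ 2 ≤
      weilDecayConst g ^ 2 / (1 + T₀ ^ 2) *
        ((riemannZetaZeroOrder (ρ : ℂ) : ℝ) / ‖(ρ : ℂ)‖ ^ 2) := by
  have hm : (0 : ℝ) ≤ riemannZetaZeroOrder (ρ : ℂ) := by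
    exact_mod_cast riemannZetaZeroOrder_nonneg (ZetaZeros.riemannZetaNontrivialZeros.ne_one ρ.2)
  have h0 := ZetaZeros.riemannZetaNontrivialZeros.re_pos ρ.2
  have h1 := ZetaZeros.riemannZetaNontrivialZeros.re_lt_one ρ.2
  have hρ0 : 0 < ‖(ρ : ℂ)‖ ^ 2 := by
    have : (ρ : ℂ) ≠ 0 := fun h ↦ by rw [h, Complex.zero_re] at h0; exact lt_irrefl _ h0
    positivity
  have hRHS : 0 ≤ weilDecayConst g ^ 2 / (1 + T₀ ^ 2) *
      ((riemannZetaZeroOrder (ρ : ℂ) : ℝ) / ‖(ρ : ℂ)‖ ^ 2) :=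
    mul_nonneg (div_nonneg (sq_nonneg _) (by positivity)) (div_nonneg hm hρ0.le)
  by_cases hγ : |(ρ : ℂ).im| ≤ T₀
  · rw [weilMellin_sub_reflect_eq_zero g (hRH ρ ρ.2 hγ), zero_div, norm_zero,
      zero_pow two_ne_zero, mul_zero]
    exact hRHS
  · push Not at hγ
    -- above the height: the decay bound and `(1+γ²)² ≥ (1+T₀²)|ρ|²`
    have hD : ‖(weilMellin g ρ - weilMellin g (1 - conj (ρ : ℂ))) / 2‖ ≤
        weilDecayConst g / (1 + (ρ : ℂ).im ^ 2) := by
      have := norm_weilMellin_sub_reflect_le_decay hg ρ.2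
      rw [norm_div, Complex.norm_ofNat]; linarith
    have hD2 : ‖(weilMellin g ρ - weilMellin g (1 - conj (ρ : ℂ))) / 2‖ ^ 2 ≤
        weilDecayConst g ^ 2 / (1 + (ρ : ℂ).im ^ 2) ^ 2 := by
      rw [← div_pow]; exact pow_le_pow_left₀ (norm_nonneg _) hD 2
    have hγ2 : T₀ ^ 2 ≤ (ρ : ℂ).im ^ 2 := by
      have := sq_le_sq' (by linarith [abs_nonneg ((ρ : ℂ).im)]) hγ.le
      rwa [sq_abs] at this
    have hnorm : ‖(ρ : ℂ)‖ ^ 2 ≤ 1 + (ρ : ℂ).im ^ 2 := by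
      rw [← Complex.normSq_eq_norm_sq, Complex.normSq_apply]
      nlinarith
    have hkey : (1 + T₀ ^ 2) * ‖(ρ : ℂ)‖ ^ 2 ≤ (1 + (ρ : ℂ).im ^ 2) ^ 2 := by
      calc (1 + T₀ ^ 2) * ‖(ρ : ℂ)‖ ^ 2 ≤ (1 + (ρ : ℂ).im ^ 2) * (1 + (ρ : ℂ).im ^ 2) :=
            mul_le_mul (by linarith) hnorm hρ0.le (by positivity)
        _ = (1 + (ρ : ℂ).im ^ 2) ^ 2 := by ring
    have hfrac : weilDecayConst g ^ 2 / (1 + (ρ : ℂ).im ^ 2) ^ 2 ≤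
        weilDecayConst g ^ 2 / (1 + T₀ ^ 2) * (1 / ‖(ρ : ℂ)‖ ^ 2) := by
      rw [div_mul_div_comm, mul_one]
      exact div_le_div_of_nonneg_left (sq_nonneg _) (by positivity) hkey
    calc (riemannZetaZeroOrder (ρ : ℂ) : ℝ) *
          ‖(weilMellin g ρ - weilMellin g (1 - conj (ρ : ℂ))) / 2‖ ^ 2
        ≤ (riemannZetaZeroOrder (ρ : ℂ) : ℝ) *
            (weilDecayConst g ^ 2 / (1 + T₀ ^ 2) * (1 / ‖(ρ : ℂ)‖ ^ 2)) :=
          mul_le_mul_of_nonneg_left (hD2.trans hfrac) hm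
      _ = _ := by ring

/-- The off-line series above a verified height is at most `(C_g²/(1 + T₀²)) ∑_ρ m(ρ)/|ρ|²`.
[folklore] -/
theorem tsum_offLine_le_of_rh_upTo {g : ℝ → ℂ} (hg : IsWeilTest g) {T₀ : ℝ} (hT₀ : 0 ≤ T₀)
    (hRH : ∀ ρ ∈ ZetaZeros.riemannZetaNontrivialZeros, |ρ.im| ≤ T₀ → ρ.re = 1 / 2) :
    ∑' ρ : ZetaZeros.riemannZetaNontrivialZeros,
        (riemannZetaZeroOrder (ρ : ℂ) : ℝ) *
          ‖(weilMellin g ρ - weilMellin g (1 - conj (ρ : ℂ))) / 2‖ ^ 2 ≤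
      weilDecayConst g ^ 2 / (1 + T₀ ^ 2) *
        ∑' ρ : ZetaZeros.riemannZetaNontrivialZeros,
          (riemannZetaZeroOrder (ρ : ℂ) : ℝ) / ‖(ρ : ℂ)‖ ^ 2 := by
  rw [← tsum_mul_left]
  exact (summable_offLine hg).tsum_le_tsum (offLine_term_le_of_rh_upTo hg hT₀ hRH)
    (FordL33.summable_order_div_norm_sq.mul_left _)

/-- **NO LEVER ABOVE A VERIFIED HEIGHT**: if every non-trivial zero of `ζ` with `|Im ρ| ≤ T₀`
(`T₀ ≥ 0`) lies on the critical line, then for EVERY smooth compactly supported `g`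
`Re Q(g) ≥ −(463/10000) · C_g² / (1 + T₀²)`, `C_g = weilDecayConst g`
(Ford 2002 Lemma 3.3: `∑_ρ m(ρ)/|ρ|² ≤ 0.0463`, the tree's `tsum_zeroOrder_div_norm_sq_le`).
Whatever happens above `T₀`, the off-line zeros can lower Weil's form at a fixed test function by
at most this much. [folklore] -/
theorem neg_le_re_weilQuadratic_of_rh_upTo {g : ℝ → ℂ} (hg : IsWeilTest g) {T₀ : ℝ}
    (hT₀ : 0 ≤ T₀)
    (hRH : ∀ ρ ∈ ZetaZeros.riemannZetaNontrivialZeros, |ρ.im| ≤ T₀ → ρ.re = 1 / 2) :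
    -(463 / 10000 * weilDecayConst g ^ 2 / (1 + T₀ ^ 2)) ≤ (weilQuadratic g).re := by
  have h1 := neg_tsum_le_re_weilQuadratic hg
  have h2 := tsum_offLine_le_of_rh_upTo hg hT₀ hRH
  have h3 : ∑' ρ : ZetaZeros.riemannZetaNontrivialZeros,
      (riemannZetaZeroOrder (ρ : ℂ) : ℝ) / ‖(ρ : ℂ)‖ ^ 2 ≤ 0.0463 :=
    tsum_zeroOrder_div_norm_sq_le
  have hC : 0 ≤ weilDecayConst g ^ 2 / (1 + T₀ ^ 2) := div_nonneg (sq_nonneg _) (by positivity)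
  have h4 := mul_le_mul_of_nonneg_left h3 hC
  have h5 : weilDecayConst g ^ 2 / (1 + T₀ ^ 2) * 0.0463 =
      463 / 10000 * weilDecayConst g ^ 2 / (1 + T₀ ^ 2) := by ring
  linarith

/-- The same with the hypothesis in the upper half-plane form used by route WeilAdversary
(`AdversaryTransfer`: `∀ s, ζ(s) = 0 → 0 < Im s → Im s ≤ T₀ → Re s = 1/2`); the lower half-plane
follows by conjugation (`riemannZeta_conj`). [folklore] -/
theorem rh_upTo_of_upper {T₀ : ℝ}
    (h : ∀ s : ℂ, riemannZeta s = 0 → 0 < s.im → s.im ≤ T₀ → s.re = 1 / 2) :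
    ∀ ρ ∈ ZetaZeros.riemannZetaNontrivialZeros, |ρ.im| ≤ T₀ → ρ.re = 1 / 2 := by
  intro ρ hρ hγ
  have hz := ZetaZeros.riemannZetaNontrivialZeros.zeta_eq_zero hρ
  have him := ZetaZeros.riemannZetaNontrivialZeros.im_ne_zero hρ
  rcases lt_or_gt_of_ne him with hneg | hpos
  · -- `Im ρ < 0`: use the conjugate zero
    have hc : riemannZeta (conj ρ) = 0 := by rw [riemannZeta_conj, hz, map_zero]
    have := h (conj ρ) hc (by simpa using hneg) (by rw [conj_im]; linarith [neg_abs_le ρ.im, abs_le.1 hγ])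
    simpa using this
  · exact h ρ hz hpos ((le_abs_self _).trans hγ)

/-- **At the Platt–Trudgian height** (`T₀ = 3 000 175 332 800`, the printed verification height of
Platt–Trudgian 2021, Bull. LMS 53; here an explicit HYPOTHESIS, inlined exactly as in
`Summit.RiemannHypothesis.RiemannHypothesis.Theses.WeilAdversary.AdversaryTransfer`): if every zero
of `ζ` with `0 < Im s ≤ 3 000 175 332 800` has `Re s = 1/2`, then for every test function
`Re Q(g) ≥ −(52/10²⁸) · C_g²`. [folklore] -/
theorem neg_le_re_weilQuadratic_plattTrudgian
    (h : ∀ s : ℂ, riemannZeta s = 0 → 0 < s.im → s.im ≤ 3000175332800 → s.re = 1 / 2)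
    {g : ℝ → ℂ} (hg : IsWeilTest g) :
    -(52 / 10 ^ 28 * weilDecayConst g ^ 2) ≤ (weilQuadratic g).re := by
  have h1 := neg_le_re_weilQuadratic_of_rh_upTo hg (T₀ := 3000175332800) (by norm_num)
    (rh_upTo_of_upper h)
  have hC := sq_nonneg (weilDecayConst g)
  have h2 : 463 / 10000 * weilDecayConst g ^ 2 / (1 + (3000175332800 : ℝ) ^ 2) ≤
      52 / 10 ^ 28 * weilDecayConst g ^ 2 := by
    rw [div_le_iff₀ (by positivity)]
    nlinarith
  linarith

end Summit.RiemannHypothesis.RiemannHypothesis.Theorems.WeilOffLine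

end
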